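import Summits.ResolutionOfSingularities.ResolutionOfSingularities.Theorems.DeltaCutRef3
import HarnessLib

/-!
# DeltaCutRef4 — decomp-res node «RefCut» (lens-6 g27, critic row 204 CLEARED (F-curve WHOLE) DECIDED +1 · MAP 0),
tree file 4/5 of the node

Content VERBATIM from the decomp-res lens-6 g27 node `HOME/decomp-res-lens-6/g27/RefCut.lean` (pin df7099b8; no
carry, imports the landed `DeltaCutSepCells` + Literature; namespace `…Theorems.DeltaCutClasses`); HOME =
run/shared/lean/pub/decomp-res; critic CRITIC-LEDGER row 204 CLEARED (F-curve WHOLE) DECIDED +1 · MAP 0; landing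
orders NEXT-g28.md §4 + INBOX :1315 (09:51:49Z) — provenance, critic text and the lens header in full in the first
file of the node, `DeltaCutRef`.  `--kind proof --supports stmt-ResolutionOfSingularities-26971`.

## This file

Continuation 4/4 of `DeltaCutRef` (same namespace / sections of the node, cut at the tree's 400-line cap; section
variables / opens replayed): scopes `RefTower`, `RefEngine` — carries `exists_reducedRegular_presolveRun`,
`wor_cons`, `blowup_facts`, `support_singCentreOf_subset`, `dimLEOne_strictClosure`, `strictClosure_subset_support`,
`refHop_facts`, `wor_of_refTerminatesAt`, `wor_of_refTerminates`, `refRun_facts`, `refRun_add_eq_presolveRun`,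
`refRun_pending_phase_ends`, `refRun_curveFrozen_exits`.

[WRITER NOTE (decomp-res writer g13): file split only (tree files ≤ 400 lines; the plan's section groups, cut
further by the cap at declaration boundaries); namespace, sections, section `open`s / `variable`s and every
declaration exactly as in the lens (the node's HOME-only dupNamespace-linter line is dropped — the library sets it;
`noncomputable section`, the two file-level `open` lines, `universe u` and the namespace-level `open
…TwistCutClasses` / `open …LightCutClasses` of the node are replayed in every file).]

(Sources: Hironaka1964; Kollar2007 Thm. 1.101; Lipman1978 §1; CossartJannsenSaito2020 §5–§6, Def. 3.13 / Thm. 3.14;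
CossartPiltant2019 Prop. 2.6; EGAIV2 §7.8; BierstoneGrigorievMilmanWlodarczyk2011 §3; Hironaka1967; Giraud1975.)
-/

noncomputable section

open CategoryTheory CategoryTheory.Limits AlgebraicGeometry TopologicalSpace IsLocalRing
open Literature.AlgebraicGeometry.Resolution

universe u

namespace Summit.ResolutionOfSingularities.ResolutionOfSingularities.Theorems.DeltaCutClasses

open Summit.ResolutionOfSingularities.ResolutionOfSingularities.Theorems.TwistCutClasses
open Summit.ResolutionOfSingularities.ResolutionOfSingularities.Theorems.LightCutClasses

section RefTower

open Summit.ResolutionOfSingularities.ResolutionOfSingularities.Theorems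
open WeakOrderReduction ForcedTowerClasses SubfieldContactClasses AbsoluteContactClasses PurityValveClasses
open Scheme.IdealSheafData (vanishingIdeal)

/-- **(T) · THE PENDING PHASE IS FINITE.**  For a base stage with a pending CURVE `S` (`dim S_red ≤ 1`), some finite iterate of
«blow up `Sing(S_red)`, pass to the strict transform» has a REGULAR reduced strict transform.  PROOF (tree currency): were all
strict transforms singular, pick a singular point at each level; its Kollár chain (`exists_chain_presolveRun`) starts at one of
the FINITELY many singular points of `S_red` (`finite_compl_regularLocus`), so one singular point `c` carries chains
of unbounded
length made of non-regular rings; but `𝒪_{S_red,c}` is a one-dimensional Noetherian local ring with reduced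
completion (reduced and
essentially of finite type over a field: `IsQuasiExcellentRing.isReduced_adicCompletion_iff`, `Stacks07QW_field_holds`), so by
**Kollár 2007 Thm. 1.101** (tree theorem `Kollar2007_thm_1_101_localChain_holds`) every long enough chain from it contains a
regular ring — contradiction. [new] [folklore] (Sources: Kollar2007, Thm. 1.101.) -/
theorem exists_reducedRegular_presolveRun {k : Type} [Field k] (n : ℕ) {P : PStage} (hP : PGood k P) :
    ∃ t, ReducedRegular (presolveRun n P t).S := by
  by_contra hall
  push Not at hall
  obtain ⟨⟨g, hB⟩, hdim⟩ := hP
  haveI := isLocallyNoetherian_of_isBase hB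
  haveI := hB.locallyOfFiniteType
  haveI := hB.quasiCompact
  haveI : IsReduced (vanishingIdeal P.S).subscheme := isReduced_subscheme_vanishingIdeal P.S
  haveI : IsLocallyNoetherian (vanishingIdeal P.S).subscheme :=
    LocallyOfFiniteType.isLocallyNoetherian (vanishingIdeal P.S).subschemeι
  have hqe : Scheme.IsQuasiExcellent (vanishingIdeal P.S).subscheme :=
    Scheme.isQuasiExcellent_of_locallyOfFiniteType Stacks07QW_field_holds ((vanishingIdeal P.S).subschemeι ≫ g)
  -- a singular point at every level
  have hsing : ∀ t, ∃ c' : (vanishingIdeal (presolveRun n P t).S).subscheme,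
      c' ∉ Scheme.regularLocus (vanishingIdeal (presolveRun n P t).S).subscheme := fun t => by
    obtain ⟨_, c, hc, rfl⟩ := singLocusOf_nonempty_of_not_reducedRegular (hall t)
    exact ⟨c, hc⟩
  choose c' hc' using hsing
  -- the base points of their chains, in the finite singular set of `S_red`
  have hchain := fun t => exists_chain_presolveRun (n := n) (⟨⟨g, hB⟩, hdim⟩ : PGood k P) t (c' t) (hc' t)
  choose b R hb hR0 hRL hlinks hnreg using hchain
  have hF : ((Scheme.regularLocus (vanishingIdeal P.S).subscheme)ᶜ).Finite := finite_compl_regularLocus hB P.S hdim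
  haveI := hF.to_subtype
  obtain ⟨⟨c₀, hc₀⟩, hinf⟩ := Finite.exists_infinite_fiber
    (fun t => (⟨b t, hb t⟩ : ↥((Scheme.regularLocus (vanishingIdeal P.S).subscheme)ᶜ)))
  have hinf' : Set.Infinite {t : ℕ | b t = c₀} := by
    have := Set.infinite_coe_iff.mp hinf
    refine Set.infinite_of_injective_forall_mem (f := fun x : ↥((fun t => (⟨b t, hb t⟩ :
      ↥((Scheme.regularLocus (vanishingIdeal P.S).subscheme)ᶜ))) ⁻¹' {⟨c₀, hc₀⟩}) => (x : ℕ))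
      Subtype.val_injective fun x => ?_
    have hx := x.2
    rw [Set.mem_preimage, Set.mem_singleton_iff] at hx
    exact congrArg Subtype.val hx
  -- Kollár's theorem at `A := 𝒪_{S_red, c₀}`
  have hc₀' : ¬ IsRegularLocalRing ((vanishingIdeal P.S).subscheme.presheaf.stalk c₀) := hc₀
  have hdimA : ringKrullDim ((vanishingIdeal P.S).subscheme.presheaf.stalk c₀) = 1 := by
    have hle := ringKrullDim_stalk_le_one hdim c₀
    have hpos : ¬ ringKrullDim ((vanishingIdeal P.S).subscheme.presheaf.stalk c₀) ≤ 0 := fun h => by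
      haveI : Ring.KrullDimLE 0 ((vanishingIdeal P.S).subscheme.presheaf.stalk c₀) := Ring.krullDimLE_iff.mpr h
      have hFd : IsField ((vanishingIdeal P.S).subscheme.presheaf.stalk c₀) := Ring.KrullDimLE.isField_of_isReduced
      letI := hFd.toField
      exact hc₀' inferInstance
    exact le_antisymm hle (Order.succ_le_of_lt (lt_of_not_ge hpos))
  have hred : IsReduced (AdicCompletion (maximalIdeal ((vanishingIdeal P.S).subscheme.presheaf.stalk c₀))
      ((vanishingIdeal P.S).subscheme.presheaf.stalk c₀)) :=
    (hqe.isQuasiExcellentRing_stalk c₀).isReduced_adicCompletion_iff.mpr inferInstance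
  obtain ⟨m, hm⟩ := Kollar2007_thm_1_101_localChain_holds _ hdimA hred
  obtain ⟨t, ht, hmt⟩ := hinf'.exists_gt m
  have hbt : b t = c₀ := ht
  obtain ⟨i, him, hreg⟩ := hm (R t) ⟨eqToIso (by rw [hR0 t, hbt]; rfl)⟩ (fun i hi => hlinks t i (lt_trans hi hmt))
  exact hnreg t i (him.trans hmt.le) hreg

end RefTower

section RefEngine

open Summit.ResolutionOfSingularities.ResolutionOfSingularities.Theorems
open WeakOrderReduction ForcedTowerClasses SubfieldContactClasses AbsoluteContactClasses PurityValveClasses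
open Scheme.IdealSheafData (vanishingIdeal)

/-! ### §RefEngine — PERMISSIBILITY OF EVERY REFINED HOP PROVED; ONE ENGINE FOR ALL HEIGHTS; THE PENDING PHASE ALONG THE RUN -/

/-- splicing one weakly admissible centre in front of a weak resolution of the transform. [folklore] -/
theorem wor_cons {Y : Scheme.{0}} (M : MarkedIdeal Y) (C : Y.IdealSheafData) (hsub : (C.support : Set Y) ⊆ M.support)
    (hreg : Scheme.IsRegular C.subscheme) (h : ∃ t', WeakResolution t' (M.transform (blowup.π C) C)) :
    ∃ t : CentreSeq Y, WeakResolution t M := by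
  obtain ⟨t', ht'⟩ := h
  exact ⟨CentreSeq.cons C t', ⟨hsub, hreg, ht'.1⟩, ht'.2⟩

/-- **ONE PERMISSIBLE BLOW-UP OF A BASE DATUM** (regular centre inside the support): base upstairs (`baseStable_holds`), datum
upstairs (`isDatum_transform_blowup`), the stage identity, and the splice. [folklore] -/
theorem blowup_facts {k : Type} [Field k] {Y : Scheme.{0}} {g : Y ⟶ Spec (.of k)} (hB : IsBase Y g) {n : ℕ}
    {M : MarkedIdeal Y} (hM : IsDatum n M) (C : Y.IdealSheafData) (hCreg : Scheme.IsRegular C.subscheme)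
    (hCsub : (C.support : Set Y) ⊆ M.support) :
    IsBase (blowup C) (blowup.π C ≫ g) ∧ IsDatum n (M.transform (blowup.π C) C) ∧
      (M.transform (blowup.π C) C).ideal = controlledTransform (blowup.π C) C M.ideal n ∧
      ((∃ t', WeakResolution t' (M.transform (blowup.π C) C)) → ∃ t : CentreSeq Y, WeakResolution t M) :=
  ⟨baseStable_holds k Y g hB C hCreg,
    isDatum_transform_blowup hB hM hCreg fun y hy => idealOrder_eq_of_mem_support hM (hCsub hy),
    by rw [MarkedIdeal.transform_ideal, hM.1], wor_cons M C hCsub hCreg⟩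

/-- the resolving centre of a pending curve inside the support lies INSIDE THE TOP LOCUS. [folklore] -/
theorem support_singCentreOf_subset {k : Type} [Field k] {Y : Scheme.{0}} {g : Y ⟶ Spec (.of k)} (hB : IsBase Y g)
    {M : MarkedIdeal Y} (S : Closeds Y) (hdim : DimLEOne S) (hsub : (S : Set Y) ⊆ M.support) :
    ((singCentreOf S).support : Set Y) ⊆ M.support := by
  rw [coe_support_singCentreOf hB S hdim]; exact (singLocusOf_subset S).trans hsub

/-- **THE STRICT TRANSFORM OF THE PENDING CURVE IS AGAIN A CURVE** (`dim ≤ 1`; it is a blow-up of `S_red`). [new] [folklore] -/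
theorem dimLEOne_strictClosure {k : Type} [Field k] {Y : Scheme.{0}} {g : Y ⟶ Spec (.of k)} (hB : IsBase Y g)
    {I : Y.IdealSheafData} (S : Closeds Y) (hdim : DimLEOne S) : DimLEOne (strictClosure (N := ⟨Y, I⟩) S) :=
  (PGood.presolve (k := k) (n := 0) (P := ⟨⟨Y, I⟩, S⟩) ⟨⟨g, hB⟩, hdim⟩).2

/-- **PERMISSIBILITY OF THE LATER RESOLVING / EXIT HOPS — THE LIMIT-POINT LEMMA for the pending curve**: the strict transform
`closure π⁻¹(S ∖ Sing S_red)` of a pending curve inside the support lies INSIDE THE SUPPORT of the transformed datum (orders off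
the centre are transported, `IsBlowup.idealOrder_controlledTransform_of_not_mem`; limit points are caught because the support
upstairs is closed, `orderUSC_holds` over the new base `baseStable_holds`). [new] [folklore] -/
theorem strictClosure_subset_support {k : Type} [Field k] {Y : Scheme.{0}} {g : Y ⟶ Spec (.of k)} (hB : IsBase Y g)
    {n : ℕ} {M : MarkedIdeal Y} (hM : IsDatum n M) (S : Closeds Y) (hdim : DimLEOne S) (hsub : (S : Set Y) ⊆ M.support) :
    (strictClosure (N := ⟨Y, M.ideal⟩) S : Set _) ⊆
      (M.transform (blowup.π (singCentreOf S)) (singCentreOf S)).support := by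
  haveI := isLocallyNoetherian_of_isBase hB
  have hB₁ : IsBase (blowup (singCentreOf S)) (blowup.π (singCentreOf S) ≫ g) :=
    baseStable_holds k Y g hB _ (isRegular_subscheme_singCentreOf hB S hdim)
  refine closure_minimal (fun y' hy' => ?_) (isClosed_support_of_isBase hB₁ _)
  obtain ⟨hyS, hyC⟩ := hy'
  have hsuppC : ((singCentreOf S).support : Set Y) = closure (singLocusOf S) := coe_support_vanishingIdeal _
  have hy'C : (blowup.π (singCentreOf S)).base y' ∉ ((singCentreOf S).support : Set Y) := by
    rw [hsuppC]; exact hyC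
  show ((M.transform _ _).mult : ℕ∞) ≤ idealOrder (M.transform _ _).ideal y'
  rw [MarkedIdeal.transform_mult, MarkedIdeal.transform_ideal, hM.1,
    (blowup.isBlowup _).idealOrder_controlledTransform_of_not_mem M.ideal n hy'C, idealOrder_eq_of_mem_support hM (hsub hyS)]

/-- **THE FACTS OF ONE REFINED HOP OF A BASE DATUM** (all four branches: exit / resolve / resolve-at-the-bad-closure
/ separate, and
the inactive stay): the next refined stage is again a base `n`-datum with a pending curve inside its support (or
nothing pending),
EVERY CENTRE BLOWN UP IS REGULAR AND INSIDE THE TOP LOCUS (permissibility PROVED: (S) for the resolving centres, the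
tests for the
exit and separating centres, the limit-point lemmas for «inside the support»), and a weak resolution of the next
datum splices to
one of the present datum. [new] [folklore] -/
theorem refHop_facts {k : Type} [Field k] {Y : Scheme.{0}} {g : Y ⟶ Spec (.of k)} (hB : IsBase Y g) {n : ℕ}
    {M : MarkedIdeal Y} (hM : IsDatum n M) (P : Option (Closeds Y))
    (hP : ∀ S, P = some S → DimLEOne S ∧ (S : Set Y) ⊆ M.support) :
    ∃ (Y₁ : Scheme.{0}) (g₁ : Y₁ ⟶ Spec (.of k)) (M₁ : MarkedIdeal Y₁) (P₁ : Option (Closeds Y₁)),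
      IsBase Y₁ g₁ ∧ IsDatum n M₁ ∧ (refHop n ⟨⟨Y, M.ideal⟩, P⟩).next = ⟨⟨Y₁, M₁.ideal⟩, P₁⟩ ∧
      (∀ S₁, P₁ = some S₁ → DimLEOne S₁ ∧ (S₁ : Set Y₁) ⊆ M₁.support) ∧
      ((∃ t', WeakResolution t' M₁) → ∃ t : CentreSeq Y, WeakResolution t M) := by
  haveI := isLocallyNoetherian_of_isBase hB
  -- the RESOLVING branch, shared by «pending irregular» and «curve-frozen»
  have resolve : ∀ S : Closeds Y, DimLEOne S → (S : Set Y) ⊆ M.support →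
      (refHop n ⟨⟨Y, M.ideal⟩, P⟩).next = (RefStage.resolve n ⟨⟨Y, M.ideal⟩, P⟩ S).next →
      ∃ (Y₁ : Scheme.{0}) (g₁ : Y₁ ⟶ Spec (.of k)) (M₁ : MarkedIdeal Y₁) (P₁ : Option (Closeds Y₁)),
        IsBase Y₁ g₁ ∧ IsDatum n M₁ ∧ (refHop n ⟨⟨Y, M.ideal⟩, P⟩).next = ⟨⟨Y₁, M₁.ideal⟩, P₁⟩ ∧
        (∀ S₁, P₁ = some S₁ → DimLEOne S₁ ∧ (S₁ : Set Y₁) ⊆ M₁.support) ∧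
        ((∃ t', WeakResolution t' M₁) → ∃ t : CentreSeq Y, WeakResolution t M) := by
    intro S hdim hsub hS
    obtain ⟨hB₁, hM₁, hI₁, hsp⟩ := blowup_facts hB hM (singCentreOf S) (isRegular_subscheme_singCentreOf hB S hdim)
      (support_singCentreOf_subset hB S hdim hsub)
    refine ⟨blowup (singCentreOf S), blowup.π (singCentreOf S) ≫ g, M.transform (blowup.π (singCentreOf S)) (singCentreOf S),
      some (strictClosure (N := ⟨Y, M.ideal⟩) S), hB₁, hM₁, ?_, ?_, hsp⟩
    · rw [hS]
      show (⟨⟨blowup (singCentreOf S), controlledTransform (blowup.π (singCentreOf S)) (singCentreOf S) M.ideal n⟩,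
        some (strictClosure (N := ⟨Y, M.ideal⟩) S)⟩ : RefStage) = _
      rw [← hI₁]
    · intro S₁ hS₁
      have e : strictClosure (N := ⟨Y, M.ideal⟩) S = S₁ := Option.some.inj hS₁
      rw [← e]
      exact ⟨dimLEOne_strictClosure hB S hdim, strictClosure_subset_support hB hM S hdim hsub⟩
  cases P with
  | some S =>
    obtain ⟨hdim, hsub⟩ := hP S rfl
    by_cases hr : ReducedRegular S
    · -- EXIT: blow up the regular pending curve itself
      have hCsub : ((vanishingIdeal S).support : Set Y) ⊆ M.support := by rw [coe_support_vanishingIdeal]; exact hsub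
      obtain ⟨hB₁, hM₁, hI₁, hsp⟩ := blowup_facts hB hM (vanishingIdeal S) hr hCsub
      refine ⟨blowup (vanishingIdeal S), blowup.π (vanishingIdeal S) ≫ g, M.transform (blowup.π (vanishingIdeal S)) (vanishingIdeal S),
        none, hB₁, hM₁, ?_, fun S₁ h => (Option.some_ne_none S₁ h.symm).elim, hsp⟩
      rw [refHop_eq_exit (N := ⟨Y, M.ideal⟩) hr]
      show (⟨⟨blowup (vanishingIdeal S), controlledTransform (blowup.π (vanishingIdeal S)) (vanishingIdeal S) M.ideal n⟩, none⟩ :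
        RefStage) = _
      rw [← hI₁]
    · exact resolve S hdim hsub (by rw [refHop_eq_resolve (N := ⟨Y, M.ideal⟩) hr])
  | none =>
    by_cases hc : CurveFrozen n ⟨Y, M.ideal⟩
    · exact resolve (badClosure n ⟨Y, M.ideal⟩) hc.2.2 (closure_badLocus_subset_support hB hM)
        (by rw [refHop_eq_resolve_badClosure hc])
    · rw [refHop_eq_sep hc]
      by_cases hact : SepActive n ⟨Y, M.ideal⟩
      · -- SEPARATE (g26's hop verbatim): step 1, and step 2 if the strict transform of the old top locus is regular
        obtain ⟨hB₁, hM₁, hI₁, hsp₁⟩ := blowup_facts hB hM (badClosureCentre n ⟨Y, M.ideal⟩) hact.2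
          (support_badClosureCentre_subset_support hB hM)
        haveI := isLocallyNoetherian_of_isBase hB₁
        have hS₁ : stepOne n ⟨Y, M.ideal⟩ = ⟨blowup (badClosureCentre n ⟨Y, M.ideal⟩),
            (M.transform (blowup.π (badClosureCentre n ⟨Y, M.ideal⟩)) (badClosureCentre n ⟨Y, M.ideal⟩)).ideal⟩ := by
          rw [MarkedIdeal.transform_ideal, hM.1]
        by_cases hreg₂ : OldTopRegular n ⟨Y, M.ideal⟩
        · obtain ⟨hB₂, hM₂, hI₂, hsp₂⟩ := blowup_facts hB₁ hM₁ (oldTopCentre n ⟨Y, M.ideal⟩) hreg₂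
            (support_oldTopCentre_subset_support hB hM hact.2)
          refine ⟨blowup (oldTopCentre n ⟨Y, M.ideal⟩), blowup.π (oldTopCentre n ⟨Y, M.ideal⟩) ≫ blowup.π _ ≫ g,
            (M.transform (blowup.π (badClosureCentre n ⟨Y, M.ideal⟩)) (badClosureCentre n ⟨Y, M.ideal⟩)).transform
              (blowup.π (oldTopCentre n ⟨Y, M.ideal⟩)) (oldTopCentre n ⟨Y, M.ideal⟩),
            none, hB₂, hM₂, ?_, fun S₁ h => (Option.some_ne_none S₁ h.symm).elim, fun h => hsp₁ (hsp₂ h)⟩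
          have hS₂ : (sepHop n ⟨Y, M.ideal⟩).next = ⟨blowup (oldTopCentre n ⟨Y, M.ideal⟩),
              (((M.transform (blowup.π (badClosureCentre n ⟨Y, M.ideal⟩)) (badClosureCentre n ⟨Y, M.ideal⟩)).transform
                (blowup.π (oldTopCentre n ⟨Y, M.ideal⟩)) (oldTopCentre n ⟨Y, M.ideal⟩))).ideal⟩ := by
            rw [sepHop_next_of_regular hact hreg₂, MarkedIdeal.transform_ideal, MarkedIdeal.transform_mult,
              MarkedIdeal.transform_ideal, hM.1]
          show (⟨(sepHop n ⟨Y, M.ideal⟩).next, none⟩ : RefStage) = _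
          rw [hS₂]
        · refine ⟨blowup (badClosureCentre n ⟨Y, M.ideal⟩), blowup.π _ ≫ g,
            M.transform (blowup.π (badClosureCentre n ⟨Y, M.ideal⟩)) (badClosureCentre n ⟨Y, M.ideal⟩),
            none, hB₁, hM₁, ?_, fun S₁ h => (Option.some_ne_none S₁ h.symm).elim, hsp₁⟩
          have hS₂ : (sepHop n ⟨Y, M.ideal⟩).next = ⟨blowup (badClosureCentre n ⟨Y, M.ideal⟩),
              (M.transform (blowup.π (badClosureCentre n ⟨Y, M.ideal⟩)) (badClosureCentre n ⟨Y, M.ideal⟩)).ideal⟩ := by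
            rw [sepHop_next_of_not_regular hact hreg₂, hS₁]
          show (⟨(sepHop n ⟨Y, M.ideal⟩).next, none⟩ : RefStage) = _
          rw [hS₂]
      · -- STAY
        refine ⟨Y, g, M, none, hB, hM, ?_, fun S₁ h => (Option.some_ne_none S₁ h.symm).elim, id⟩
        show (⟨(sepHop n ⟨Y, M.ideal⟩).next, none⟩ : RefStage) = _
        rw [sepHop_next_of_not_active hact]

/-- **THE REFINED ENGINE, ITERATED (one theorem for ALL heights).**  For every `h`: a base `n`-datum, with nothing pending or a
pending curve inside its support, whose refined run MOVES below level `h` and has NOTHING PENDING and EMPTY bad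
locus at level `h`
has a weak resolution, given `SeqDimFour 5 n` — induction on `h` (`h = 0`: g23's closing law `wor_of_splitOrLightOrDeltaLight`;
`h + 1`: `refHop_facts` + the tail identity `refRun_succ_front` + the splice). [new] [folklore] -/
theorem wor_of_refTerminatesAt {n : ℕ} (hn : 1 ≤ n) (h5 : SeqDimFour 5 n) (p : ℕ) (hp : p.Prime) (k : Type) [Field k]
    [CharP k p] : ∀ (h : ℕ) (Y : Scheme.{0}) (g : Y ⟶ Spec (.of k)), IsBase Y g → ∀ M : MarkedIdeal Y, IsDatum n M →
      ∀ P : Option (Closeds Y), (∀ S, P = some S → DimLEOne S ∧ (S : Set Y) ⊆ M.support) →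
      (∀ j < h, RefMoves n (refRun n ⟨⟨Y, M.ideal⟩, P⟩ j)) → (refRun n ⟨⟨Y, M.ideal⟩, P⟩ h).pending = none →
      BadEmpty n (refRun n ⟨⟨Y, M.ideal⟩, P⟩ h).base → ∃ t : CentreSeq Y, WeakResolution t M := by
  intro h
  induction h with
  | zero =>
    intro Y g hB M hM P _ _ _ hemp
    have hemp' : badLocus Y M.ideal n = ∅ := hemp
    refine wor_of_splitOrLightOrDeltaLight hn h5 p hp k Y g hB M hM fun y' hw => Or.inr ?_
    by_contra hnd
    have hy' : y' ∈ badLocus Y M.ideal n := ⟨hw.1, hw.2.1, hw.2.2, hnd⟩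
    rw [hemp'] at hy'
    exact hy'
  | succ h ih =>
    intro Y g hB M hM P hP hpre hpend hemp
    obtain ⟨Y₁, g₁, M₁, P₁, hB₁, hM₁, hS, hP₁, hsp⟩ := refHop_facts hB hM P hP
    have e : ∀ j, refRun n ⟨⟨Y, M.ideal⟩, P⟩ (j + 1) = refRun n ⟨⟨Y₁, M₁.ideal⟩, P₁⟩ j := fun j => by
      rw [refRun_succ_front, hS]
    refine hsp (ih Y₁ g₁ hB₁ M₁ hM₁ P₁ hP₁ (fun j hj => ?_) ?_ ?_)
    · have := hpre (j + 1) (Nat.succ_lt_succ hj); rwa [e] at this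
    · have := hpend; rwa [e] at this
    · have := hemp; rwa [e] at this

/-- **THE REFINED ENGINE · the decided cell closes**: a base `n`-datum whose refined run TERMINATES has a weak resolution, given
`SeqDimFour 5 n`. [new] [folklore] -/
theorem wor_of_refTerminates {n : ℕ} (hn : 1 ≤ n) (h5 : SeqDimFour 5 n) (p : ℕ) (hp : p.Prime) (k : Type) [Field k]
    [CharP k p] (Y : Scheme.{0}) (g : Y ⟶ Spec (.of k)) (hB : IsBase Y g) (M : MarkedIdeal Y) (hM : IsDatum n M)
    (href : RefTerminates n ⟨⟨Y, M.ideal⟩, none⟩) : ∃ t : CentreSeq Y, WeakResolution t M := by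
  obtain ⟨h, hpre, hpend, hemp⟩ := href
  exact wor_of_refTerminatesAt hn h5 p hp k h Y g hB M hM none (fun S h => (Option.some_ne_none S h.symm).elim) hpre hpend hemp

/-- **EVERY LEVEL OF THE REFINED RUN OF A BASE DATUM IS A BASE DATUM** (with nothing pending or a pending curve inside its
support) — the invariant behind (T) along the run. [new] [folklore] -/
theorem refRun_facts {k : Type} [Field k] {Y : Scheme.{0}} {g : Y ⟶ Spec (.of k)} (hB : IsBase Y g) {n : ℕ}
    {M : MarkedIdeal Y} (hM : IsDatum n M) (P : Option (Closeds Y))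
    (hP : ∀ S, P = some S → DimLEOne S ∧ (S : Set Y) ⊆ M.support) : ∀ i : ℕ,
    ∃ (Yᵢ : Scheme.{0}) (gᵢ : Yᵢ ⟶ Spec (.of k)) (Mᵢ : MarkedIdeal Yᵢ) (Pᵢ : Option (Closeds Yᵢ)),
      IsBase Yᵢ gᵢ ∧ IsDatum n Mᵢ ∧ refRun n ⟨⟨Y, M.ideal⟩, P⟩ i = ⟨⟨Yᵢ, Mᵢ.ideal⟩, Pᵢ⟩ ∧
      (∀ Sᵢ, Pᵢ = some Sᵢ → DimLEOne Sᵢ ∧ (Sᵢ : Set Yᵢ) ⊆ Mᵢ.support)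
  | 0 => ⟨Y, g, M, P, hB, hM, rfl, hP⟩
  | i + 1 => by
    obtain ⟨Yᵢ, gᵢ, Mᵢ, Pᵢ, hBᵢ, hMᵢ, e, hPᵢ⟩ := refRun_facts hB hM P hP i
    obtain ⟨Y₁, g₁, M₁, P₁, hB₁, hM₁, hS, hP₁, -⟩ := refHop_facts hBᵢ hMᵢ Pᵢ hPᵢ
    exact ⟨Y₁, g₁, M₁, P₁, hB₁, hM₁, by rw [refRun_succ, e, hS], hP₁⟩

/-- **THE PENDING PHASE OF THE RUN IS THE PURE RESOLVING TOWER**: while the strict transforms stay irregular, the refined run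
from a level `⟨N, some S⟩` follows `presolveRun`. [folklore] -/
theorem refRun_add_eq_presolveRun (n : ℕ) (R₀ : RefStage) (i : ℕ) (P : PStage)
    (e : refRun n R₀ i = ⟨P.N, some P.S⟩) : ∀ L : ℕ, (∀ t < L, ¬ ReducedRegular (presolveRun n P t).S) →
      refRun n R₀ (i + L) = ⟨(presolveRun n P L).N, some (presolveRun n P L).S⟩
  | 0, _ => e
  | L + 1, hL => by
    rw [← Nat.add_assoc, refRun_succ, refRun_add_eq_presolveRun n R₀ i P e L fun t ht => hL t (Nat.lt_succ_of_lt ht),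
      refHop_eq_resolve (hL L (Nat.lt_succ_self L))]
    rfl

/-- **(S)+(T) ALONG THE RUN · EVERY PENDING PHASE OF THE REFINED RUN OF A BASE DATUM ENDS**: if level `i` has a pending curve,
some later level has nothing pending (the pure tower reaches a regular strict transform, `exists_reducedRegular_presolveRun`,
and the next hop is the EXIT). [new] [folklore] -/
theorem refRun_pending_phase_ends {k : Type} [Field k] {Y : Scheme.{0}} {g : Y ⟶ Spec (.of k)} (hB : IsBase Y g) {n : ℕ}
    {M : MarkedIdeal Y} (hM : IsDatum n M) (P : Option (Closeds Y))
    (hP : ∀ S, P = some S → DimLEOne S ∧ (S : Set Y) ⊆ M.support) (i : ℕ)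
    (hi : (refRun n ⟨⟨Y, M.ideal⟩, P⟩ i).pending.isSome = true) :
    ∃ j, i < j ∧ (refRun n ⟨⟨Y, M.ideal⟩, P⟩ j).pending = none := by
  classical
  obtain ⟨Yᵢ, gᵢ, Mᵢ, Pᵢ, hBᵢ, hMᵢ, e, hPᵢ⟩ := refRun_facts hB hM P hP i
  cases Pᵢ with
  | none =>
    have : (refRun n ⟨⟨Y, M.ideal⟩, P⟩ i).pending.isSome = false := by
      have := congrArg (fun R : RefStage => R.pending.isSome) e; simpa using this
    rw [this] at hi; exact absurd hi Bool.false_ne_true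
  | some S =>
    obtain ⟨hdim, -⟩ := hPᵢ S rfl
    have hgood : PGood k (⟨⟨Yᵢ, Mᵢ.ideal⟩, S⟩ : PStage) := ⟨⟨gᵢ, hBᵢ⟩, hdim⟩
    have hex := exists_reducedRegular_presolveRun n hgood
    let t₀ := Nat.find hex
    have ht₀ : ReducedRegular (presolveRun n ⟨⟨Yᵢ, Mᵢ.ideal⟩, S⟩ t₀).S := Nat.find_spec hex
    have hlt : ∀ t < t₀, ¬ ReducedRegular (presolveRun n ⟨⟨Yᵢ, Mᵢ.ideal⟩, S⟩ t).S := fun t ht => Nat.find_min hex ht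
    have eL := refRun_add_eq_presolveRun n ⟨⟨Y, M.ideal⟩, P⟩ i ⟨⟨Yᵢ, Mᵢ.ideal⟩, S⟩ e t₀ hlt
    refine ⟨i + t₀ + 1, by omega, ?_⟩
    have E : refRun n ⟨⟨Y, M.ideal⟩, P⟩ (i + t₀ + 1) =
        (RefStage.exit n ⟨(presolveRun n ⟨⟨Yᵢ, Mᵢ.ideal⟩, S⟩ t₀).N, some (presolveRun n ⟨⟨Yᵢ, Mᵢ.ideal⟩, S⟩ t₀).S⟩
          (presolveRun n ⟨⟨Yᵢ, Mᵢ.ideal⟩, S⟩ t₀).S).next := by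
      rw [refRun_succ, eL, refHop_eq_exit ht₀]
    have := congrArg (fun R : RefStage => R.pending.isSome) E
    simp only [RefStage.exit] at this
    exact Option.not_isSome_iff_eq_none.mp (by rw [this]; exact Bool.false_ne_true)

/-- **A CURVE-FROZEN LEVEL IS NEVER FINAL, AND ITS PENDING PHASE ENDS**: at a curve-frozen level of the refined run
of a base datum
the run MOVES (resolving hop), and some later level has nothing pending again — the WHOLE sub-kind F-curve of g26's kind F is
absorbed by the refined law, by (S) and (T), not by re-lettering. [new] [folklore] -/
theorem refRun_curveFrozen_exits {k : Type} [Field k] {Y : Scheme.{0}} {g : Y ⟶ Spec (.of k)} (hB : IsBase Y g) {n : ℕ}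
    {M : MarkedIdeal Y} (hM : IsDatum n M) (i : ℕ) (hnone : (refRun n ⟨⟨Y, M.ideal⟩, none⟩ i).pending = none)
    (hc : CurveFrozen n (refRun n ⟨⟨Y, M.ideal⟩, none⟩ i).base) :
    RefMoves n (refRun n ⟨⟨Y, M.ideal⟩, none⟩ i) ∧ ∃ j, i + 1 < j ∧ (refRun n ⟨⟨Y, M.ideal⟩, none⟩ j).pending = none := by
  refine ⟨refMoves_of_curveFrozen hc, ?_⟩
  refine refRun_pending_phase_ends hB hM none (fun S h => (Option.some_ne_none S h.symm).elim) (i + 1) ?_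
  rw [refRun_succ, (refRun n ⟨⟨Y, M.ideal⟩, none⟩ i).eq_ofStage hnone, refHop_eq_resolve_badClosure hc]
  rfl

end RefEngine

end Summit.ResolutionOfSingularities.ResolutionOfSingularities.Theorems.DeltaCutClasses
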